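/-
Copyright (c) 2026 the pub-hodgecm-mathlib formalisation cell (harness21).  Prover seat hodgecm-mathlib-K2E1-p14 (g2), Track B «K2-LIT» ENGINE E1, h413 =
`stmt-HodgeConjecture-24833`, route `HCCMUnconditional`, 5Res ROADCARD «ENDGAME BY FAMILIES» §3′ D4′c (SD) AT M1 — THE PLUG (dealer K2E1-plan (g7) (271)): ★ p860865 §2 with the
entry letter `hs`, the residue letters `hr∕hRsymm∕hRpos` and the functional equation `hFE` DISCHARGED on the package clauses; `hB`, `hSD` visible.
-/
import Summits.HodgeConjecture.HodgeConjecture.Theorems.K2E1ChiSectionPlancherelSelfDualM1CMTwo        -- ★ p860865 (this seat): `exists_linearIsometry_chiSection_selfDual_m1_cm_two`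
import Summits.HodgeConjecture.HodgeConjecture.Theorems.K2E1ChiScatteringRealPolesM1CMTwoComplete     -- ★ p860788 (K2E1-p13): brings ★ LetterFree `chi_scattering_hs_of_scalarPackage_m1_cm_two`, ★ p860766 `chi_scattering_fe_m1_cm_two`, ★ p860725 `hdec_maximalLevel_cm_two`
import Summits.HodgeConjecture.HodgeConjecture.Theorems.K2E1ChiMaassSelbergResidueM1CMTwo             -- ★ p860849 (K2E4-p11): `chi_maassSelberg_residue_m1_cm_two`
import HarnessLib

/-!
# D4′c (SD) at M1, THE PLUG — `K2E1ChiSectionPlancherelSelfDualM1CMTwoComplete`: the self-dual block isometry of `U(1,1)_{L∕L⁺}` at `K′ = K_max`, `ω = 1`, HYPOTHESIS-FIRST ON THE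
# SCATTERING PACKAGE'S CLAUSES, with `hs`, `hr∕hRsymm∕hRpos`, `hFE` (and `hadj`, `hcont`) ALL DISCHARGED — only the strip bound `hB` and the two-term Gram letter `hSD` remain

Track B ∕ K2-LIT, crux h413 = `stmt-HodgeConjecture-24833`, route of record `HCCMUnconditional`; cell `hodgecm-mathlib`, squad K2, ENGINE E1.  THEOREMS ONLY (no `def`, no `instance`,
no `notation`, no named-fact hypothesis, no `sorry`; default heartbeats); lane `--supports stmt-HodgeConjecture-24833 --as helper` (count-neutral).

THE MATHEMATICS ([MoeglinWaldspurger1995, II.2.4, IV.1.10–IV.1.11, IV.3.12]; [Langlands1976, §7]; [Iwaniec2002, §7.3]).  ONE SOURCE (K2E1-p12's rule): every M1 letter of the self-dual road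
is typed on the CLAUSES of the scattering package of the M1 datum `(χ, φ)` at the singleton basis `{φ}` (★ K2E4-p14 `exists_scattering_scalar_package_selfDual_m1_cm_two` ∕ ★ K2E1-p13
`chi_scattering_real_poles_m1_complete_cm_two`): tube coordinates `q`, continued scalar `qc default`, Eisenstein family `Ec`, ONE pole set `P`, the (E1)–(E4) clauses, the skolemised
per-ball truncated `L²`-families `(U_n, T₀(n), Fam_n)` and the Godement tube formula `hs_tube`.  ON THOSE CLAUSES this file discharges, for `s := qc default`: the entry letter `hs` with
its finset `S ⊂ (½, σ₀)` of genuine real poles (★ `chi_scattering_hs_of_scalarPackage_m1_cm_two`, sockets `hdec` ← ★ `hdec_maximalLevel_cm_two`, (FE) ← ★ `chi_scattering_fe_m1_cm_two`);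
the residue letters — at every real `c > ½` the residue `r_c = lim (z − c)·κ⟪φ_K, ψ(z)⟫` of the rank-one scattering pairing exists, is real and `≥ 0` (★ `chi_maassSelberg_residue_m1_cm_two`,
Maass–Selberg at fixed `T`), whence by the RANK-ONE RESCALING `ψ(z) = s(z)•φ_K` (§1) the scalar residues `ρ_c = r_c ∕ (κ‖φ_K‖²)`, real, `≥ 0`; the scalar (FE); and ★ p860865 §2 supplies
`hadj` (★ p860445) and `hcont` (★ p860080).  VISIBLE: the strip bound `hB` (`‖s z‖ ≤ B` on `{½ < Re ≤ σ₀, |Im| ≥ 1}` — K2E1-p15, ★ p860833's functional once typed on THESE clauses) and the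
pure-tensor two-term Gram letter `hSD` on `Re z = σ₀` (K2E3-p12 H-c at M1, coefficient `s z·⟪ṽ_b, ṽ_a⟫_W`).
* §1 `tendsto_sub_mul_of_rankOne_pairing` — the rank-one rescaling of a residue limit (generic inner-product space).
* §2 HEAD **`exists_linearIsometry_chiSection_selfDual_m1_cm_two_of_package`**.  CONSUMER RECIPE (RUNG 1): `obtain ⟨bV, q, Ec, qc, P, hbV, ⟨hq, hqφ, hEcNF, hqNF, hE1, hqcq, hPc, hPcd, hPre,
  hEan, hqa, hEdiff, hqdiff, hEcont, hF⟩, hs_tube, -⟩ := chi_scattering_real_poles_m1_complete_cm_two …`, rewrite `hqφ` through `hbV` (`• φ`), `choose U T₀ Fam … using hF`, then this head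
  with K2E1-p15's `hB` and K2E3-p12's `hSD` on the same clauses.
CONCLUSION: `∃ S ρ r′ w U` — `S` the genuine real poles of `s` in `(½, σ₀)`, `ρ_c` the (real, non-negative) residues of `s` at `c ∈ S`, `⟪r′_i, r′_j⟫ = C·Σ_{c∈S} ⟪Ψ̂_i(−c), ρ_c•Ψ̂_j(−c)⟫_W`,
`w_i =ᵐ Ψ̂_i(−(½+it)) + s(½−it)•Ψ̂_i(−(½−it))`, **`U (Σ_a y_{i,a}) = (r′_i, √(C∕2π)•w_i)`**, `U : closure span {Σ_a y_{i,a}} →ₗᵢ[ℂ] (⊕_{c∈S} W) ⊕₂ L²((0,∞); W)`.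
HONEST LABEL: HC_CM is proved only modulo the 7 printed citations (2 remaining named inputs: hLiu418 = `stmt-HodgeConjecture-24832`, h413 = `stmt-HodgeConjecture-24833`) until rung 0
closes; this file asserts no named fact, closes no socket; count-neutral; letters: the package clauses (one `obtain` of ★ p860788), `hB`, `hSD`.

## References
* [MoeglinWaldspurger1995] C. Mœglin, J.-L. Waldspurger, *Spectral decomposition and Eisenstein series* (1995), II.2.4, IV.1.10–IV.1.11, IV.3.12.
* [Langlands1976] R. P. Langlands, *On the Functional Equations Satisfied by Eisenstein Series*, LNM 544 (1976), §7.
* [Iwaniec2002] H. Iwaniec, *Spectral Methods of Automorphic Forms* (2nd ed., 2002), §7.3.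
-/

set_option autoImplicit false
set_option linter.dupNamespace false  -- the mandated namespace repeats the summit's segment (`HodgeConjecture.HodgeConjecture`)

noncomputable section

open MeasureTheory MeasureTheory.Measure Set NumberField IsDedekindDomain Filter Topology Complex
open scoped Real NNReal ENNReal ComplexConjugate InnerProductSpace BigOperators
open Literature.MeasureTheory.Group Literature.NumberTheory
open Literature.NumberTheory.Automorphic Literature.NumberTheory.Automorphic.UnitaryGroup AdelicGroupData
open Literature.NumberTheory.GaloisRepresentations
open Summit.HodgeConjecture.HodgeConjecture.Cruxes.H413.K2E1BorelEisensteinU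
open Summit.HodgeConjecture.HodgeConjecture.Cruxes.H413.K2E1BLBorelSpacesU2Defs
open Summit.HodgeConjecture.HodgeConjecture.Cruxes.H413.K2E1BLBorelOperatorsU2Defs
open Summit.HodgeConjecture.HodgeConjecture.Cruxes.H413.K2E1CharacterEisensteinU2Defs
open Summit.HodgeConjecture.HodgeConjecture.Cruxes.H413.K2E1ChiSectionSpaceU2Defs
open Summit.HodgeConjecture.HodgeConjecture.Cruxes.H413.K2E1ChiSectionPlancherelSelfDualM1CMTwo (exists_linearIsometry_chiSection_selfDual_m1_cm_two)
open Summit.HodgeConjecture.HodgeConjecture.Cruxes.H413.K2E1ChiScatteringRealPolesM1CMTwoLetterFree (chi_scattering_hs_of_scalarPackage_m1_cm_two)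
open Summit.HodgeConjecture.HodgeConjecture.Cruxes.H413.K2E1ChiScatteringRealPolesM1CMTwoFinal (ne_zero_of_coeFn_ae_eq)
open Summit.HodgeConjecture.HodgeConjecture.Cruxes.H413.K2E1ChiScatteringFunctionalEquationM1CMTwo (chi_scattering_fe_m1_cm_two)
open Summit.HodgeConjecture.HodgeConjecture.Cruxes.H413.K2E1ChiMaassSelbergDecayLetterM1CMTwo (hdec_maximalLevel_cm_two)
open Summit.HodgeConjecture.HodgeConjecture.Cruxes.H413.K2E1ChiMaassSelbergResidueM1CMTwo (chi_maassSelberg_residue_m1_cm_two)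
open Summit.HodgeConjecture.HodgeConjecture.Cruxes.H413.K2E1ChiScatteringConjSymmetryM1CMTwo (chi_scattering_conj_symm_m1_cm_two exists_galTwist_cm)
open Summit.HodgeConjecture.HodgeConjecture.Cruxes.H413.K2E1MaassSelbergSphericalBracketsCMThree (idelicBracket_pos)
open Summit.HodgeConjecture.HodgeConjecture.Cruxes.H413.K2E1ChiMaassSelbergContinuedModelsCMTwo (real_mul_inner_self)
open Summit.HodgeConjecture.HodgeConjecture.Cruxes.H413.K2E1PlancherelIsometryOfForm (mem_topologicalClosure_span)

namespace Summit.HodgeConjecture.HodgeConjecture.Cruxes.H413.K2E1ChiSectionPlancherelSelfDualM1CMTwoComplete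

/-! ## §1 The rank-one rescaling of a residue limit -/

/-- **RANK-ONE RESCALING.**  If `(z − c)·(κ·(1·⟪φ_K, Σ_{j : Unit} s_j(z)•φ_K⟫))` tends to `r` along a filter, then `(z − c)·s_default(z)` tends to `r ∕ (κ‖φ_K‖²)` (`κ > 0`,
`φ_K ≠ 0`): the scattering pairing of a rank-one block is `s(z)·κ‖φ_K‖²`. [folklore] -/
theorem tendsto_sub_mul_of_rankOne_pairing {E : Type*} [NormedAddCommGroup E] [InnerProductSpace ℂ E] {φK : E} (hφK0 : φK ≠ 0) {κ : ℝ} (hκ : 0 < κ)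
    {qc : Unit → ℂ → ℂ} {c r : ℂ} {l : Filter ℂ}
    (h : Tendsto (fun z : ℂ => (z - c) * (((κ : ℝ) : ℂ) * (((1 : ℝ) : ℂ) * ⟪φK, ∑ j : Unit, qc j z • φK⟫_ℂ))) l (𝓝 r)) :
    Tendsto (fun z : ℂ => (z - c) * qc default z) l (𝓝 (r / (((κ * ‖φK‖ ^ 2 : ℝ)) : ℂ))) := by
  have hA : (((κ * ‖φK‖ ^ 2 : ℝ)) : ℂ) ≠ 0 := ofReal_ne_zero.2 (mul_pos hκ (pow_pos (norm_pos_iff.2 hφK0) 2)).ne'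
  have key : ((κ : ℝ) : ℂ) * (((1 : ℝ) : ℂ) * ⟪φK, φK⟫_ℂ) = (((κ * ‖φK‖ ^ 2 : ℝ)) : ℂ) := by
    rw [real_mul_inner_self κ 1 φK, mul_one]
  have hform : ∀ z : ℂ, (z - c) * (((κ : ℝ) : ℂ) * (((1 : ℝ) : ℂ) * ⟪φK, ∑ j : Unit, qc j z • φK⟫_ℂ)) = (z - c) * qc default z * (((κ * ‖φK‖ ^ 2 : ℝ)) : ℂ) := fun z => by
    simp only [Fintype.sum_unique, inner_smul_right]
    rw [← key]
    ring
  have h' : Tendsto (fun z : ℂ => (z - c) * qc default z * (((κ * ‖φK‖ ^ 2 : ℝ)) : ℂ) * ((((κ * ‖φK‖ ^ 2 : ℝ)) : ℂ))⁻¹) l (𝓝 (r * ((((κ * ‖φK‖ ^ 2 : ℝ)) : ℂ))⁻¹)) :=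
    (h.congr hform).mul_const _
  simpa only [mul_inv_cancel_right₀ hA, div_eq_mul_inv] using h'

/-- The rescaled residue `r ∕ (κ‖φ_K‖²)` is real and non-negative when `r` is. [folklore] -/
theorem div_real_im_re {r : ℂ} (hrim : r.im = 0) (hrre : 0 ≤ r.re) {A : ℝ} (hA : 0 < A) : (r / ((A : ℝ) : ℂ)).im = 0 ∧ 0 ≤ (r / ((A : ℝ) : ℂ)).re := by
  rw [div_ofReal_im, div_ofReal_re, hrim, zero_div]
  exact ⟨rfl, div_nonneg hrre hA.le⟩

/-! ## §2 HEAD: the (SD) block isometry at M1, hypothesis-first on the package clauses -/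

section CM

variable (L : Type) [Field L] [NumberField L] [IsCMField L]
variable [MeasurableSpace (quasiSplit (↥(maximalRealSubfield L)) L (IsCMField.complexConj L) 2).Adelic] [BorelSpace (quasiSplit (↥(maximalRealSubfield L)) L (IsCMField.complexConj L) 2).Adelic]
variable [MeasurableSpace (AdeleRing (𝓞 L) L)ˣ] [BorelSpace (AdeleRing (𝓞 L) L)ˣ]

/-- **HEAD — THE SELF-DUAL BLOCK ISOMETRY OF `U(1,1)_{L∕L⁺}` AT THE MAXIMAL LEVEL, ON THE PACKAGE CLAUSES, `hB` AND `hSD` VISIBLE.**  Binders: B1∕B2's structural data (`μ νG μK νI 𝓕I ν 𝓕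
β μZ`); `χ` self-dual unitary trivial on `ℝ_{>0}`; the M1 section `φ ∈ V(χ, K_max, 1)` continuous bounded with `φ ∘ ι_∞ = φ(1)`, `φ(1) ≠ 0` real; the PACKAGE CLAUSES at the singleton
basis `{φ}` (`hqφ hqNF hE1 hqcq hPc hPcd hPre hqa`, the skolemised per-ball families `U hUo hUcod T₀ hT₀ Fam hFd hFam`, the tube formula `hs_tube`) — ONE `obtain` of ★
`chi_scattering_real_poles_m1_complete_cm_two`; the model data `v y f` of ★ p860865; `σ₀ > 1`; VISIBLE LETTERS `hB` (strip bound of `s := qc default`) and `hSD` (pure-tensor two-term Gram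
letter, coefficient `s z·⟪ṽ_b, ṽ_a⟫_W`).  DISCHARGED INSIDE: `hs∕S` (★ LetterFree ∘ ★ hdec ∘ ★ (FE)), `ρ∕hr∕hρim∕hρre` (★ residue print ∘ §1), `hFE` (★ σ2), `hadj`, `hcont` (★ p860865 §2).
CONCLUSION: `∃ S ρ r′ w U`, `S ⊂ (½, σ₀)` the genuine real poles of `s`, `ρ_c` its residues (real, `≥ 0`), `⟪r′_i, r′_j⟫ = C·Σ_{c∈S} ⟪Ψ̂_i(−c), ρ_c•Ψ̂_j(−c)⟫_W`,
`w_i =ᵐ Ψ̂_i(−(½+it)) + s(½−it)•Ψ̂_i(−(½−it))`, **`U (Σ_a y_{i,a}) = (r′_i, √(C∕2π)•w_i)`**. [cite: MoeglinWaldspurger1995, II.2.4, IV.1.11 and IV.3.12] [cite: Langlands1976, §7]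
[cite: Iwaniec2002, §7.3] -/
theorem exists_linearIsometry_chiSection_selfDual_m1_cm_two_of_package
    (μ : Measure (quasiSplit (↥(maximalRealSubfield L)) L (IsCMField.complexConj L) 2).automorphicQuotient) [(quasiSplit (↥(maximalRealSubfield L)) L (IsCMField.complexConj L) 2).IsAutomorphicMeasure μ]
    (νG : Measure (quasiSplit (↥(maximalRealSubfield L)) L (IsCMField.complexConj L) 2).Adelic) [νG.IsHaarMeasure] [νG.IsInvInvariant] [SFinite νG]
    (μK : Measure ↥((standardMaximalCompactGL 2 L).comap (adelicVal (↥(maximalRealSubfield L)) L (IsCMField.complexConj L) 2 ((StdForm.antidiagonal 2).over L)) : Subgroup (quasiSplit (↥(maximalRealSubfield L)) L (IsCMField.complexConj L) 2).Adelic)) [μK.IsHaarMeasure]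
    (νI : Measure (AdeleRing (𝓞 L) L)ˣ) [νI.IsHaarMeasure]
    {𝓕I : Set (AdeleRing (𝓞 L) L)ˣ} (h𝓕I : IsIdeleClassDomain L 𝓕I)
    (ν : Measure ↥(adelicUnipotent (↥(maximalRealSubfield L)) L (IsCMField.complexConj L) 2)) [ν.IsHaarMeasure] [ν.IsMulRightInvariant] [ν.IsInvInvariant]
    {𝓕 : Set ↥(adelicUnipotent (↥(maximalRealSubfield L)) L (IsCMField.complexConj L) 2)} (h𝓕N : IsFundamentalDomain ↥(rationalUnipotent (↥(maximalRealSubfield L)) L (IsCMField.complexConj L) 2) 𝓕 ν) (h𝓕1 : ν 𝓕 = 1)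
    (h𝓕c : IsCompact (closure 𝓕))
    {β : (quasiSplit (↥(maximalRealSubfield L)) L (IsCMField.complexConj L) 2).Adelic → ℝ≥0∞} (hβ : IsCoveringWeight ↥((arithmeticBorel (↥(maximalRealSubfield L)) L (IsCMField.complexConj L) 2).map (quasiSplit (↥(maximalRealSubfield L)) L (IsCMField.complexConj L) 2).arithmeticSubgroup.subtype) β)
    {μZ : Measure (borelQuotient (↥(maximalRealSubfield L)) L (IsCMField.complexConj L) 2)} [SFinite μZ]
    (hμZ : ∀ f : borelQuotient (↥(maximalRealSubfield L)) L (IsCMField.complexConj L) 2 → ℝ≥0∞, Measurable f → ∫⁻ z, f z ∂μZ = ∫⁻ g, β g * f (toBorelQuotient (↥(maximalRealSubfield L)) L (IsCMField.complexConj L) 2 g) ∂νG)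
    -- the self-dual unitary character, trivial on `ℝ_{>0}`, and the normalised non-degenerate M1 section
    {χ : HeckeCharacter L} (hχ : χ.IsUnitary) (hρ : ∀ r : ℝ≥0ˣ, χ (posRealIdele L r) = 1) (hsd : reflectChar (IsCMField.complexConj L) χ = χ)
    {φ : (quasiSplit (↥(maximalRealSubfield L)) L (IsCMField.complexConj L) 2).Adelic → ℂ} (hφV : φ ∈ chiSectionSpace χ ((standardMaximalCompactGL 2 L).comap (adelicVal (↥(maximalRealSubfield L)) L (IsCMField.complexConj L) 2 ((StdForm.antidiagonal 2).over L)) : Subgroup (quasiSplit (↥(maximalRealSubfield L)) L (IsCMField.complexConj L) 2).Adelic) (fun _ => 1)) (hφc : Continuous φ) {Mφ : ℝ} (hφM : ∀ x, ‖φ x‖ ≤ Mφ)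
    (hφinf : ∀ a : arch (↥(maximalRealSubfield L)) L (IsCMField.complexConj L) 2 ((StdForm.antidiagonal 2).over L), φ (archToAdelic (↥(maximalRealSubfield L)) L (IsCMField.complexConj L) 2 _ a) = φ 1)
    (hφ1 : φ 1 ≠ 0) (hφ1r : conj (φ 1) = φ 1)
    -- the package clauses at the singleton basis (`b := φ`): ONE `obtain` of ★ `chi_scattering_real_poles_m1_complete_cm_two` (+ `choose` on its per-ball families)
    {q qc : Unit → ℂ → ℂ} {Ec : ℂ → (quasiSplit (↥(maximalRealSubfield L)) L (IsCMField.complexConj L) 2).Adelic → ℂ} {P : Set ℂ}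
    (hqφ : ∀ z : ℂ, 1 < z.re → (∑ j, q j z • φ) = ((((ν 𝓕).toReal⁻¹ : ℝ)) : ℂ) • (fun g : (quasiSplit (↥(maximalRealSubfield L)) L (IsCMField.complexConj L) 2).Adelic => (∫ v : ↥(adelicUnipotent (↥(maximalRealSubfield L)) L (IsCMField.complexConj L) 2), flatSectionU φ z ((quasiSplit (↥(maximalRealSubfield L)) L (IsCMField.complexConj L) 2).toAdelic (weylLongU ((IsCMField.complexConj L : L ≃ₐ[↥(maximalRealSubfield L)] L) : L →+* L) (rfl : (StdForm.antidiagonal 2).over L = (StdForm.antidiagonal 2).over L)) * ((v : (quasiSplit (↥(maximalRealSubfield L)) L (IsCMField.complexConj L) 2).Adelic) * g)) ∂ν) * (((borelHeight g : ℝ) : ℂ) ^ (z - 1))))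
    (hqNF : ∀ j, MeromorphicNFOn (qc j) univ) (hE1 : ∀ z : ℂ, 1 < z.re → Ec z = eisensteinSeriesU (flatSectionU φ z)) (hqcq : ∀ j (z : ℂ), 1 < z.re → qc j z = q j z)
    (hPc : IsClosed P) (hPcd : ∀ z₀ : ℂ, ∀ᶠ s in 𝓝[≠] z₀, s ∉ P) (hPre : ∀ z ∈ P, z.re ≤ 1) (hqa : ∀ j (z : ℂ), z ∉ P → AnalyticAt ℂ (qc j) z)
    (U : ℕ → Set ℂ) (hUo : ∀ n, IsOpen (U n)) (hUcod : ∀ n : ℕ, ∀ z₀ ∈ Metric.ball (0 : ℂ) (n + 2), ∀ᶠ s in 𝓝[≠] z₀, s ∈ U n)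
    (T₀ : ℕ → ℝ≥0) (hT₀ : ∀ n, 1 ≤ T₀ n) (Fam : ℕ → ℂ → Lp ℂ 2 μ) (hFd : ∀ n, DifferentiableOn ℂ (Fam n) (U n \ P))
    (hFam : ∀ n, ∀ z ∈ U n \ P, ((Fam n z : Lp ℂ 2 μ) : (quasiSplit (↥(maximalRealSubfield L)) L (IsCMField.complexConj L) 2).automorphicQuotient → ℂ) =ᵐ[μ] (quasiSplit (↥(maximalRealSubfield L)) L (IsCMField.complexConj L) 2).quotFun (truncation ν 𝓕 (T₀ n) (Ec z)))
    (hs_tube : ∀ z : ℂ, 1 < z.re → qc default z = (((ν 𝓕).toReal⁻¹ : ℝ) : ℂ) * ((φ 1)⁻¹ * ∫ v : ↥(adelicUnipotent (↥(maximalRealSubfield L)) L (IsCMField.complexConj L) 2), flatSectionU φ z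
        ((quasiSplit (↥(maximalRealSubfield L)) L (IsCMField.complexConj L) 2).toAdelic (weylLongU (IsCMField.complexConj L : L →+* L)
          (rfl : (StdForm.antidiagonal 2).over L = (StdForm.antidiagonal 2).over L)) * ((v : (quasiSplit (↥(maximalRealSubfield L)) L (IsCMField.complexConj L) 2).Adelic) * 1)) ∂ν))
    -- the model data of ★ p860865 (`W := span {v_a} ≤ L²(K_max, μ_K)`, test functions, classes)
    {ι α : Type*} [Fintype α] (v : α → Lp ℂ 2 μK) (y : ι → α → Lp ℂ 2 μ) {f : ι → α → ℝ → ℂ}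
    (hf : ∀ i a, ContDiff ℝ 2 (f i a)) (hfs : ∀ i a, HasCompactSupport (f i a)) (hf0 : ∀ i a, tsupport (f i a) ⊆ Ioi 0)
    {σ₀ : ℝ} (hσ₀ : 1 < σ₀)
    -- THE TWO VISIBLE LETTERS: the strip bound (K2E1-p15) and the pure-tensor two-term Gram letter (K2E3-p12 H-c at M1)
    {B : ℝ} (hB : ∀ z : ℂ, 1 / 2 < z.re → z.re ≤ σ₀ → 1 ≤ |z.im| → ‖qc default z‖ ≤ B)
    {C : ℝ} (hC : 0 ≤ C)
    (hSD : ∀ i j a b, ⟪y i b, y j a⟫_ℂ = (C : ℂ) * ((((2 * π)⁻¹ : ℝ) : ℂ) * ∫ t : ℝ, mellin (f j a) (-((σ₀ : ℂ) + t * I)) *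
      (⟪(⟨v b, Submodule.subset_span ⟨b, rfl⟩⟩ : ↥(Submodule.span ℂ (Set.range v))), ⟨v a, Submodule.subset_span ⟨a, rfl⟩⟩⟫_ℂ * conj (mellin (f i b) (-(1 - conj ((σ₀ : ℂ) + t * I)))) +
        qc default ((σ₀ : ℂ) + t * I) * ⟪(⟨v b, Submodule.subset_span ⟨b, rfl⟩⟩ : ↥(Submodule.span ℂ (Set.range v))), ⟨v a, Submodule.subset_span ⟨a, rfl⟩⟩⟫_ℂ *
          conj (mellin (f i b) (-conj ((σ₀ : ℂ) + t * I)))))) :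
    ∃ (S : Finset ℝ) (ρ : ℝ → ℂ) (r' : ι → PiLp 2 (fun _ : ↥S => ↥(Submodule.span ℂ (Set.range v)))) (w : ι → Lp ↥(Submodule.span ℂ (Set.range v)) 2 ((volume : Measure ℝ).restrict (Ioi 0)))
      (Uiso : (Submodule.span ℂ (Set.range fun i => ∑ a, y i a)).topologicalClosure →ₗᵢ[ℂ]
        WithLp 2 (PiLp 2 (fun _ : ↥S => ↥(Submodule.span ℂ (Set.range v))) × Lp ↥(Submodule.span ℂ (Set.range v)) 2 ((volume : Measure ℝ).restrict (Ioi 0)))),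
      (∀ c ∈ S, ¬ AnalyticAt ℂ (qc default) (c : ℂ) ∧ 1 / 2 < c ∧ c < σ₀) ∧
      (∀ c ∈ S, Tendsto (fun z : ℂ => (z - c) * qc default z) (𝓝[≠] (c : ℂ)) (𝓝 (ρ c)) ∧ (ρ c).im = 0 ∧ 0 ≤ (ρ c).re) ∧
      (∀ i j, ⟪r' i, r' j⟫_ℂ = (C : ℂ) * ∑ c ∈ S, ⟪∑ b, mellin (f i b) (-(c : ℂ)) • (⟨v b, Submodule.subset_span ⟨b, rfl⟩⟩ : ↥(Submodule.span ℂ (Set.range v))),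
        ρ c • ∑ a, mellin (f j a) (-(c : ℂ)) • (⟨v a, Submodule.subset_span ⟨a, rfl⟩⟩ : ↥(Submodule.span ℂ (Set.range v)))⟫_ℂ) ∧
      (∀ i, (w i : ℝ → ↥(Submodule.span ℂ (Set.range v))) =ᵐ[(volume : Measure ℝ).restrict (Ioi 0)] fun t =>
        (∑ a, mellin (f i a) (-((((1 / 2 : ℝ)) : ℂ) + t * I)) • (⟨v a, Submodule.subset_span ⟨a, rfl⟩⟩ : ↥(Submodule.span ℂ (Set.range v)))) +
          qc default ((((1 / 2 : ℝ)) : ℂ) + ((-t : ℝ) : ℂ) * I) •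
            ∑ a, mellin (f i a) (-((((1 / 2 : ℝ)) : ℂ) + ((-t : ℝ) : ℂ) * I)) • (⟨v a, Submodule.subset_span ⟨a, rfl⟩⟩ : ↥(Submodule.span ℂ (Set.range v)))) ∧
      (∀ i, Uiso ⟨∑ a, y i a, mem_topologicalClosure_span (fun i => ∑ a, y i a) i⟩ = WithLp.toLp 2 (r' i, ((Real.sqrt (C * (2 * π)⁻¹) : ℝ) : ℂ) • w i)) := by
  classical
  have hφ0 : φ ≠ 0 := fun h => hφ1 (by rw [h, Pi.zero_apply])
  have h𝓕₀ : ν 𝓕 ≠ 0 := by rw [h𝓕1]; exact one_ne_zero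
  -- the sockets on THESE clauses: constant-term decay above every level (★ K2E1-p12) and the scalar functional equation (★ σ2)
  have hdec := hdec_maximalLevel_cm_two L ν h𝓕N h𝓕c hχ hφV hφc hφM hφinf
  have hFE : ∀ z : ℂ, z ∉ P → 1 - z ∉ P → qc default z * qc default (1 - z) = 1 :=
    chi_scattering_fe_m1_cm_two L μ νG ν h𝓕N h𝓕c h𝓕₀ hβ hμZ hsd hφV hφc hφM hφinf hφ0 hqφ hqcq hPc hPcd hPre hqa
  -- the entry letter `hs` and the finset `S` of genuine real poles (★ LetterFree §1)
  have hbill := chi_scattering_hs_of_scalarPackage_m1_cm_two L μ νG μK νI h𝓕I ν h𝓕N h𝓕1 h𝓕c hβ hχ hρ hsd hφV hφc hφM hφ1 hφ1r hqφ hqNF hE1 hqcq hPc hPcd hPre hqa U hUo hUcod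
    T₀ hT₀ Fam hFd hFam hs_tube hdec hFE hσ₀
  -- (conj) for the scalar on the tube formula (★ p860445), all indices `j : Unit`
  have hφK : ∀ k : (quasiSplit (↥(maximalRealSubfield L)) L (IsCMField.complexConj L) 2).Adelic,
      adelicVal (↥(maximalRealSubfield L)) L (IsCMField.complexConj L) 2 ((StdForm.antidiagonal 2).over L) k ∈ standardMaximalCompactGL 2 L → ∀ g, φ (g * k) = φ g :=
    fun k hk g => by simpa only [one_mul] using apply_mul_of_mem hφV g ⟨k, hk⟩
  have hconj' : ∀ j (z : ℂ), z ∉ P → conj z ∉ P → qc j (conj z) = conj (qc j z) := by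
    intro j
    obtain rfl : j = default := Subsingleton.elim _ _
    obtain ⟨cG, hcG⟩ := exists_galTwist_cm L
    exact chi_scattering_conj_symm_m1_cm_two L hcG ν ((ν 𝓕).toReal⁻¹) hsd hχ (isChiSection_of_mem hφV) hφK hφ1r hφ1r hPc hPcd hPre (hqa default) hs_tube
  -- the `L²(K_max)`-class of `φ|_{K_max}`: non-zero, a one-element linearly independent family
  haveI : CompactSpace ↥((standardMaximalCompactGL 2 L).comap (adelicVal (↥(maximalRealSubfield L)) L (IsCMField.complexConj L) 2 ((StdForm.antidiagonal 2).over L)) : Subgroup (quasiSplit (↥(maximalRealSubfield L)) L (IsCMField.complexConj L) 2).Adelic) :=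
    isCompact_iff_compactSpace.1 isCompact_comap_adelicVal_standardMaximalCompactGL
  haveI : IsFiniteMeasure μK := CompactSpace.isFiniteMeasure
  have hφKm : MemLp (fun k : ↥((standardMaximalCompactGL 2 L).comap (adelicVal (↥(maximalRealSubfield L)) L (IsCMField.complexConj L) 2 ((StdForm.antidiagonal 2).over L)) : Subgroup (quasiSplit (↥(maximalRealSubfield L)) L (IsCMField.complexConj L) 2).Adelic) => φ (k : (quasiSplit (↥(maximalRealSubfield L)) L (IsCMField.complexConj L) 2).Adelic)) 2 μK :=
    MemLp.of_bound (hφc.comp continuous_subtype_val).aestronglyMeasurable Mφ (Eventually.of_forall fun k => hφM _)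
  have hφKae : (((hφKm.toLp _ : Lp ℂ 2 μK)) : _ → ℂ) =ᵐ[μK] fun k => φ (k : (quasiSplit (↥(maximalRealSubfield L)) L (IsCMField.complexConj L) 2).Adelic) := MemLp.coeFn_toLp _
  have hφK0 : (hφKm.toLp _ : Lp ℂ 2 μK) ≠ 0 := ne_zero_of_coeFn_ae_eq L μK hφV hφ0 _ hφKae
  have hbKli : LinearIndependent ℂ (fun _ : Unit => (hφKm.toLp _ : Lp ℂ 2 μK)) := linearIndependent_unique_iff.2 hφK0
  have hκ := idelicBracket_pos νI h𝓕I
  -- the residues at every real `c > ½` (★ p860849), rescaled to the scalar (§1)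
  have hres : ∀ c : ℝ, 1 / 2 < c → ∃ ρc : ℂ, Tendsto (fun z : ℂ => (z - c) * qc default z) (𝓝[≠] (c : ℂ)) (𝓝 ρc) ∧ ρc.im = 0 ∧ 0 ≤ ρc.re := by
    intro c hc
    obtain ⟨-, u, r, cμ, K, -, -, -, hr, him, hre, -⟩ := chi_maassSelberg_residue_m1_cm_two L μ νG μK νI h𝓕I ν h𝓕N h𝓕1 h𝓕c hβ hχ hρ hsd hφc (isChiSection_of_mem hφV) hφM
      (fun _ : Unit => φ) hqφ hqNF hE1 hqcq hPc hPcd hqa (hφKm.toLp _) hφKae hφK0 (fun _ : Unit => (hφKm.toLp _ : Lp ℂ 2 μK)) (fun _ => hφKae) hbKli hκ U hUo hUcod T₀ hT₀ Fam hFd hFam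
      (fun n z' hz' => hdec (T₀ n) (hT₀ n) z' hz') hconj' (fun _ => rfl) hc
    exact ⟨_, tendsto_sub_mul_of_rankOne_pairing (φK := (hφKm.toLp _ : Lp ℂ 2 μK)) (qc := qc) (c := (c : ℂ)) hφK0 hκ hr,
      div_real_im_re him hre (mul_pos hκ (pow_pos (norm_pos_iff.2 hφK0) 2))⟩
  choose! ρ hρt hρim hρre using hres
  -- assemble (no top-level `obtain` in front of this goal — `Exists.elim` instead): the poles `S`, then ★ p860865 §2 with `s := qc default`, `r := (ν𝓕)⁻¹`, `φ₀ := φ`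
  refine hbill.2.elim fun S hSU => hSU.elim fun U' hU' => ?_
  have hS := hU'.1
  refine (exists_linearIsometry_chiSection_selfDual_m1_cm_two L μ μK v y hf hfs hf0 hsd hχ hφV hφ1r ν ((ν 𝓕).toReal⁻¹) (hqNF default) hPc hPcd hPre
    (hqa default) hs_tube (show (1 / 2 : ℝ) < σ₀ by linarith) hU'.2.1 hU'.2.2.1 S (fun c hc => ⟨(hS c hc).2.1, (hS c hc).2.2⟩) hU'.2.2.2 ρ
    (fun c hc => hρt c (hS c hc).2.1) (fun c hc => hρim c (hS c hc).2.1) (fun c hc => hρre c (hS c hc).2.1) hB hFE hC hSD).elim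
    fun r' hr' => hr'.elim fun w hw => hw.elim fun Uiso hU => ?_
  exact ⟨S, ρ, r', w, Uiso, hS, fun c hc => ⟨hρt c (hS c hc).2.1, hρim c (hS c hc).2.1, hρre c (hS c hc).2.1⟩, hU.1, hU.2.1, hU.2.2⟩

end CM

end Summit.HodgeConjecture.HodgeConjecture.Cruxes.H413.K2E1ChiSectionPlancherelSelfDualM1CMTwoComplete

end
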